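import Literature.AlgebraicGeometry.Frobenioids.DivisorMonoidCategoryTheoreticityProofs
import Literature.AlgebraicGeometry.Frobenioids.PrimesEquivalence
import Literature.AlgebraicGeometry.Frobenioids.PrimesMonoidIsoRight
import HarnessLib

/-!
# Frobenioids I, Theorem 4.2 (ii), (iii) AS TYPED (`PreFrobenioidData.Thm42ii`, `Thm42iii`) —
# conditional discharges ((ii): perfect type + Thm. 3.4 (ii) + Thm. 4.2 (i); (iii): Thm. 3.4 (ii)(iii) +
# Thm. 4.2 (i) + the conclusion of (ii) for the given family `e`)

Mochizuki, *The geometry of Frobenioids I: the general theory*, Kyushu J. Math. **62** (2008)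
293–400, §4, Theorem 4.2 (ii), kurims text pp. 77–80 [cite: MochizukiFrdI2008, Thm. 4.2 (ii) p.77].

PROOF-ONLY companion of `DivisorMonoidCategoryTheoreticityDefs.lean` (statements, seat abc-iut-L1-t3):
the typed statement `S₁.Thm42ii S₂ Ψ` for the operations `S_i = PreFrobenioidData.ofFunctor Φ_i F_i` of
two Frobenioids, DERIVED FROM: `F_i` Frobenioids (`hF_i`) of PERFECT type with `Φ_i` perf-factorial
(the printed standing hypothesis of Thm. 4.2, p. 77), and the conclusions of Thm. 3.4 (ii) ("`Ψ`
preserves pre-steps", for `Ψ` and `Ψ⁻¹`, here with steps) and of Thm. 4.2 (i) ("`Ψ` preserves primary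
steps", for `Ψ` and `Ψ⁻¹`) taken as HYPOTHESES — an honest CONDITIONAL discharge: the printed proof
first reduces the standard-type case to the perfect-type case by "passing to the perfections" (p. 78,
Prop. 5.5 (iii), seat abc-iut-L1-t5) and uses Thm. 3.4 (ii)(iii) (seat abc-iut-L1-t13) and part (i); those
inputs are not re-proved here. The mathematics is `PreFrobenioid.existsUnique_primesEquiv_family`
(`PrimesEquivalence.lean`), read through the adapter's `Iff` lemmas; and `S₁.Thm42iii S₂ Ψ e`, for ANY
family `e` satisfying the clauses of `Thm42ii` (hypothesis `he`), from the conclusions of Thm. 3.4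
(ii)(iii) and Thm. 4.2 (i) as hypotheses — the mathematics being `PreFrobenioid.exists_rightIso` /
`exists_leftIso` (`PrimesMonoidIso{Left,Right}.lean`) and the monoid kernel of seat abc-iut-L1-d10
(`MonoprimeEquivMul.lean`); no perfectness is needed for (iii). No new definitions.
-/

namespace Literature.AlgebraicGeometry.Frobenioids

open CategoryTheory Opposite

namespace PreFrobenioidData

universe w v v' u u' w₂ v₂ v₂' u₂ u₂'

variable {D : Type u} [Category.{v} D] {Φ : Dᵒᵖ ⥤ CommMonCat.{w}} {C : Type u'} [Category.{v'} C]
  (F : C ⥤ ElemFrobenioid Φ)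

/-- Co-angular pre-step, through the adapter. [cite: MochizukiFrdI2008, Def. 1.2 (iii) p.22] -/
theorem ofFunctor_isCoAngularPreStep {A B : C} (φ : A ⟶ B) :
    (ofFunctor Φ F).IsCoAngularPreStep φ ↔ PreFrobenioid.IsCoAngularPreStep F φ :=
  and_congr (ofFunctor_isCoAngular F φ) Iff.rfl

/-- Div-Frobenius-trivial object, through the adapter. [cite: MochizukiFrdI2008, Def. 1.2 (iv) p.22] -/
theorem ofFunctor_isDivFrobeniusTrivial (A : C) :
    (ofFunctor Φ F).IsDivFrobeniusTrivial A ↔ PreFrobenioid.IsDivFrobeniusTrivial F A := by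
  simp only [PreFrobenioidData.IsDivFrobeniusTrivial, PreFrobenioid.IsDivFrobeniusTrivial,
    ofFunctor_isDivIdentity, ofFunctor_isFrobeniusType]
  rfl

variable {F}
variable {D₂ : Type u₂} [Category.{v₂} D₂] {Φ₂ : D₂ᵒᵖ ⥤ CommMonCat.{w₂}} {C₂ : Type u₂'}
  [Category.{v₂'} C₂] {F₂ : C₂ ⥤ ElemFrobenioid Φ₂} (Ψ : C ≌ C₂)

/-- **Theorem 4.2 (ii) as typed (`Thm42ii`), perfect-type case, conditional on Thm. 3.4 (ii) and
Thm. 4.2 (i)**: for Frobenioids `C_i → F_{Φ_i}` of perfect type with `Φ_i` perf-factorial and an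
equivalence `Ψ` such that `Ψ`, `Ψ⁻¹` preserve steps, pre-steps and primary pre-steps, the typed
statement `Thm42ii` holds: a unique family `Ψ^Prime(A) : Prime(Φ₁(A)) ≃ Prime(Φ₂(Ψ A))` compatible
with `Div` of co-angular pre-steps out of and into `A` (isotropy is read off `Thm42Setting`).
[cite: MochizukiFrdI2008, Thm. 4.2 (ii) p.77] -/
theorem thm42ii_of_perfectType (hF : PreFrobenioid.IsFrobenioid F) (hF₂ : PreFrobenioid.IsFrobenioid F₂)
    (hperf : PreFrobenioid.IsOfPerfectType F) (hperf₂ : PreFrobenioid.IsOfPerfectType F₂)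
    (hpf : Objectwise (fun M _ => IsPerfFactorial M) Φ)
    (hpf₂ : Objectwise (fun M _ => IsPerfFactorial M) Φ₂)
    (hstep : ∀ ⦃X Y : C⦄ (φ : X ⟶ Y), PreFrobenioid.IsStep F φ →
      PreFrobenioid.IsStep F₂ (Ψ.functor.map φ))
    (hstep' : ∀ ⦃X Y : C₂⦄ (φ : X ⟶ Y), PreFrobenioid.IsStep F₂ φ →
      PreFrobenioid.IsStep F (Ψ.inverse.map φ))
    (hpre : ∀ ⦃X Y : C⦄ (φ : X ⟶ Y), PreFrobenioid.IsPreStep F φ →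
      PreFrobenioid.IsPreStep F₂ (Ψ.functor.map φ))
    (hpre' : ∀ ⦃X Y : C₂⦄ (φ : X ⟶ Y), PreFrobenioid.IsPreStep F₂ φ →
      PreFrobenioid.IsPreStep F (Ψ.inverse.map φ))
    (hprim : ∀ ⦃X Y : C⦄ (φ : X ⟶ Y), PreFrobenioid.IsPrimaryPreStep F φ →
      PreFrobenioid.IsPrimaryPreStep F₂ (Ψ.functor.map φ))
    (hprim' : ∀ ⦃X Y : C₂⦄ (φ : X ⟶ Y), PreFrobenioid.IsPrimaryPreStep F₂ φ →
      PreFrobenioid.IsPrimaryPreStep F (Ψ.inverse.map φ)) :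
    (ofFunctor Φ F).Thm42ii (ofFunctor Φ₂ F₂) Ψ := by
  intro hS
  have histr := (ofFunctor_isOfIsotropicType F).mp hS.isotropic.1
  have histr₂ := (ofFunctor_isOfIsotropicType F₂).mp hS.isotropic.2
  obtain ⟨e, he, hu⟩ := PreFrobenioid.existsUnique_primesEquiv_family Ψ hF hF₂ hperf hperf₂ histr histr₂
    hpf hpf₂ hstep hstep' hpre hpre' hprim hprim'
  refine ⟨e, fun A 𝔭 => ⟨fun B φ hφ => (he A 𝔭).1 φ ((ofFunctor_isCoAngularPreStep F φ).mp hφ),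
    fun B ψ hψ => (he A 𝔭).2 ψ ((ofFunctor_isCoAngularPreStep F ψ).mp hψ)⟩, fun e' he' => hu e' ?_⟩
  intro A 𝔭
  exact ⟨fun B φ hφ => (he' A 𝔭).1 φ ((ofFunctor_isCoAngularPreStep F φ).mpr hφ),
    fun B ψ hψ => (he' A 𝔭).2 ψ ((ofFunctor_isCoAngularPreStep F ψ).mpr hψ)⟩


/-- **Theorem 4.2 (iii) as typed (`Thm42iii`), conditional on Thm. 3.4 (ii)(iii), Thm. 4.2 (i) and the
conclusion of Thm. 4.2 (ii) for the family `e`**: for Frobenioids `C_i → F_{Φ_i}` with `Φ_i` perf-factorial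
and an equivalence `Ψ` such that `Ψ`, `Ψ⁻¹` preserve pre-steps, `Ψ` preserves morphisms of Frobenius type
and Frobenius degrees [Thm. 3.4 (ii)(iii)] and Div-identity endomorphisms [Thm. 4.2 (i)], and a family
`e A : Prime(Φ₁(A)) ≃ Prime(Φ₂(Ψ A))` satisfying the two clauses of `Thm42ii` [Thm. 4.2 (ii)] — all
HYPOTHESES — the typed statement `Thm42iii e` holds: for Div-Frobenius-trivial `A` and every `𝔭`, the
right-hand and left-hand ISOMORPHISMS OF MONOIDS `Φ₁(A)_𝔭 ≃* Φ₂(Ψ A)_{e A 𝔭}` computing the divisors of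
the images of co-angular pre-steps out of / into `A` (isotropy read off `Thm42Setting`).
[cite: MochizukiFrdI2008, Thm. 4.2 (iii) p.78] -/
theorem thm42iii_of (hF : PreFrobenioid.IsFrobenioid F) (hF₂ : PreFrobenioid.IsFrobenioid F₂)
    (hpf : Objectwise (fun M _ => IsPerfFactorial M) Φ)
    (hpf₂ : Objectwise (fun M _ => IsPerfFactorial M) Φ₂)
    (hpre : ∀ ⦃X Y : C⦄ (φ : X ⟶ Y), PreFrobenioid.IsPreStep F φ →
      PreFrobenioid.IsPreStep F₂ (Ψ.functor.map φ))
    (hpre' : ∀ ⦃X Y : C₂⦄ (φ : X ⟶ Y), PreFrobenioid.IsPreStep F₂ φ →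
      PreFrobenioid.IsPreStep F (Ψ.inverse.map φ))
    (hfrob : ∀ ⦃X Y : C⦄ (φ : X ⟶ Y), PreFrobenioid.IsFrobeniusType F φ →
      PreFrobenioid.IsFrobeniusType F₂ (Ψ.functor.map φ))
    (hdeg : ∀ ⦃X Y : C⦄ (φ : X ⟶ Y), PreFrobenioid.degFr F₂ (Ψ.functor.map φ) = PreFrobenioid.degFr F φ)
    (hdivid : ∀ (A : C) (α : A ⟶ A), PreFrobenioid.IsDivIdentity F α →
      PreFrobenioid.IsDivIdentity F₂ (Ψ.functor.map α))
    (e : ∀ A : C, Primes (Φ.obj (op (PreFrobenioid.baseObj F A))) ≃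
      Primes (Φ₂.obj (op (PreFrobenioid.baseObj F₂ (Ψ.functor.obj A)))))
    (he : ∀ (A : C) (𝔭 : Primes (Φ.obj (op (PreFrobenioid.baseObj F A)))),
      (∀ ⦃B : C⦄ (φ : A ⟶ B), PreFrobenioid.IsCoAngularPreStep F φ →
          (PreFrobenioid.Div F φ ∈ 𝔭.submonoid ↔
            PreFrobenioid.Div F₂ (Ψ.functor.map φ) ∈ (e A 𝔭).submonoid)) ∧
        ∀ ⦃B : C⦄ (ψ : B ⟶ A), PreFrobenioid.IsCoAngularPreStep F ψ →
          ((∃ y ∈ 𝔭.submonoid, Frobenioids.pull Φ (PreFrobenioid.Base F ψ) y = PreFrobenioid.Div F ψ) ↔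
            ∃ y ∈ (e A 𝔭).submonoid, Frobenioids.pull Φ₂ (PreFrobenioid.Base F₂ (Ψ.functor.map ψ)) y =
              PreFrobenioid.Div F₂ (Ψ.functor.map ψ))) :
    (ofFunctor Φ F).Thm42iii (ofFunctor Φ₂ F₂) Ψ e := by
  intro hS A hA 𝔭
  have histr := (ofFunctor_isOfIsotropicType F).mp hS.isotropic.1
  have histr₂ := (ofFunctor_isOfIsotropicType F₂).mp hS.isotropic.2
  have hA' := (ofFunctor_isDivFrobeniusTrivial F A).mp hA
  constructor
  · obtain ⟨r, hr⟩ := PreFrobenioid.exists_rightIso Ψ hF hF₂ histr histr₂ hpf hpf₂ hpre hpre' hfrob hdeg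
      hA' (hdivid A) 𝔭 (e A 𝔭) (he A 𝔭).1
    exact ⟨r, fun B φ hφ h => hr φ ((ofFunctor_isCoAngularPreStep F φ).mp hφ) h⟩
  · obtain ⟨l, hl⟩ := PreFrobenioid.exists_leftIso Ψ hF hF₂ histr histr₂ hpf hpf₂ hpre hpre' hfrob hdeg
      hA' (hdivid A) 𝔭 (e A 𝔭) (he A 𝔭).2
    exact ⟨l, fun B ψ hψ y h hyx => hl ψ ((ofFunctor_isCoAngularPreStep F ψ).mp hψ) y h hyx⟩

end PreFrobenioidData

end Literature.AlgebraicGeometry.Frobenioids
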